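import Summits.BirchSwinnertonDyer.Rank1Residual.X11b.FrameRigidityKernel
import Mathlib.RingTheory.PowerSeries.Binomial
import Mathlib.NumberTheory.Padics.MahlerBasis
import HarnessLib

/-!
# X11b — the BINOMIAL UNIT `(1+T)^σ ∈ 𝓞_{ℂ_p}⟦T⟧` (`σ ∈ ℤ_p`) and its values at principal units;
# adherent points of `x^ℤ` are `ℤ_p`-powers of `x`

HONEST FRAMING (cell `b2b-bsdres`, run/shared/lean/b2b/bsd-rank1-residual/, verbatim in every
file): the goal of the cell is to DELETE the COMBINATION-SHAPED residual classes of the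
Birch–Swinnerton-Dyer formula for ALL analytic-rank `≤ 1` elliptic curves over `ℚ` — "full BSD
formula for every rank `≤ 1` curve in class `C`" assembled STRICTLY from published theorems — so
that the rank-`≤ 1` remainder becomes exactly the CONSTRUCTION-SHAPED classes, which are TYPED
(missing-input `Prop`s), NOT attempted. This is not "finishing BSD". Sub-cell
`b2b-bsdres-multr1-p1` (X11b, route R1, gen 25); THEOREMS ONLY (no definition, no named fact, no
`sorry`); valid at every prime `p`; nothing here changes a label.

## Why this file (step III-b of IDEAL RIGIDITY ACROSS PERIODS, INTENT HOME/INBOX.md 2026-08-21)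

When the ratio `b` IS adherent to the powers `x^n` of the base point, the two frames differ by the
group-like unit `(1+T)^σ`: this file provides that unit and its values.

* §1 `R1.mem_range_of_not_separated` — if no `δ > 0` separates `b` from `{x^n : n ∈ ℤ}` then `b` is a
  value `χ(σ)` of the continuous character `χ : ℤ_p → ℂ_pˣ` with `χ(1) = x` (x11b3-p7's
  `exists_zpPow`; the range is compact, hence closed).
* §2 **`R1.binomialUnit_hasValueAt`** — for `σ ∈ ℤ_p` the power series
  `U_σ := (PowerSeries.binomialSeries ℤ_p σ).map R1.toCpInt = Σ_n C(σ,n) T^n ∈ 𝓞_{ℂ_p}⟦T⟧` (Mathlib's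
  binomial series over the binomial ring `ℤ_p`) takes at `y − 1`, for every continuous character
  `ψ : ℤ_p → ℂ_pˣ` with `ψ(1) = y`, `‖y − 1‖ < 1`, the value `ψ(σ)` — by density of `ℕ ⊂ ℤ_p`
  (`PadicInt.denseRange_natCast`, `PadicInt.continuous_choose`; at `σ = m ∈ ℕ` it is the finite
  binomial theorem); `R1.isUnit_binomialUnit` (constant term `1`).

References: [Washington1997] §5.1 (the functions `(1+T)^x`); Mathlib `RingTheory/PowerSeries/Binomial`,
`NumberTheory/Padics/MahlerBasis`.
-/

noncomputable section

open scoped Classical Topology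
open Filter Finset PowerSeries
open Literature.NumberTheory.EllipticCurves

namespace Summit.BirchSwinnertonDyer.Rank1Residual.X11b

variable {p : ℕ} [Fact p.Prime]

/-! ### §1 Adherent points of `x^ℤ` -/

/-- **Adherent points of `x^ℤ` are `ℤ_p`-powers of `x`.** If `χ : ℤ_p → ℂ_pˣ` is a continuous
character with `χ(1) = x` and NO `δ > 0` has `δ ≤ ‖b − x^n‖` for all `n : ℤ`, then `b = χ(σ)` for some
`σ ∈ ℤ_p` (`χ(n) = x^n`; the range of `χ` is compact, hence closed, and `b` is adherent to it).
[cite: Washington1997, §5.1] -/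
theorem R1.mem_range_of_not_separated {x b : ℂ_[p]} (χ : Multiplicative ℤ_[p] →* ℂ_[p]ˣ)
    (hχc : Continuous χ) (hχ1 : ((χ (Multiplicative.ofAdd 1) : ℂ_[p]ˣ) : ℂ_[p]) = x)
    (h : ¬ ∃ δ : ℝ, 0 < δ ∧ ∀ n : ℤ, δ ≤ ‖b - x ^ n‖) :
    ∃ σ : Multiplicative ℤ_[p], ((χ σ : ℂ_[p]ˣ) : ℂ_[p]) = b := by
  push Not at h
  -- `χ(n) = x^n`
  have hχn : ∀ n : ℤ, ((χ (Multiplicative.ofAdd (n : ℤ_[p])) : ℂ_[p]ˣ) : ℂ_[p]) = x ^ n := by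
    intro n
    rw [show (Multiplicative.ofAdd (n : ℤ_[p])) = (Multiplicative.ofAdd (1 : ℤ_[p])) ^ n by
      rw [← ofAdd_zsmul, zsmul_eq_mul, mul_one], map_zpow, Units.val_zpow_eq_zpow_val, hχ1]
  -- the range is closed and `b` is adherent to it
  set f : Multiplicative ℤ_[p] → ℂ_[p] := fun σ => ((χ σ : ℂ_[p]ˣ) : ℂ_[p]) with hf
  have hfc : Continuous f := Units.continuous_val.comp hχc
  have hclosed : IsClosed (Set.range f) := (isCompact_range hfc).isClosed
  have hmem : b ∈ closure (Set.range f) := by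
    rw [Metric.mem_closure_iff]
    intro δ hδ
    obtain ⟨n, hn⟩ := h δ hδ
    exact ⟨x ^ n, ⟨Multiplicative.ofAdd (n : ℤ_[p]), hχn n⟩, by rwa [dist_eq_norm]⟩
  rw [hclosed.closure_eq] at hmem
  obtain ⟨σ, hσ⟩ := hmem
  exact ⟨σ, hσ⟩

/-! ### §2 The binomial unit and its values -/

/-- Coefficients of the binomial unit in `ℂ_p`: `[T^n] U_σ = C(σ, n)` (cast from `ℤ_p`). [folklore] -/
theorem R1.coeff_binomialUnit (σ : ℤ_[p]) (n : ℕ) :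
    ((coeff n ((binomialSeries ℤ_[p] σ).map (R1.toCpInt p)) : 𝓞_ℂ_[p]) : ℂ_[p]) =
      algebraMap ℚ_[p] ℂ_[p] ((Ring.choose σ n : ℤ_[p]) : ℚ_[p]) := by
  rw [coeff_map, binomialSeries_coeff, smul_eq_mul, mul_one, R1.coe_toCpInt]

/-- The binomial unit has constant term `1`, hence is a UNIT of `𝓞_{ℂ_p}⟦T⟧`. [folklore] -/
theorem R1.isUnit_binomialUnit (σ : ℤ_[p]) :
    IsUnit ((binomialSeries ℤ_[p] σ).map (R1.toCpInt p)) := by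
  rw [isUnit_iff_constantCoeff, ← coeff_zero_eq_constantCoeff_apply, coeff_map, binomialSeries_coeff,
    Ring.choose_zero_right, one_smul, map_one]
  exact isUnit_one

/-- Norm of a `ℤ_p`-coefficient in `ℂ_p` is `≤ 1`. [folklore] -/
theorem R1.norm_algebraMap_padicInt_le_one (z : ℤ_[p]) :
    ‖algebraMap ℚ_[p] ℂ_[p] (z : ℚ_[p])‖ ≤ 1 := by
  rw [norm_algebraMap']; exact z.2

/-- **Values of the binomial unit**: for `‖y − 1‖ < 1`, a continuous character `ψ : ℤ_p → ℂ_pˣ` with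
`ψ(1) = y`, and `σ ∈ ℤ_p`: `U_σ(y − 1) = ψ(σ)`, i.e. `Σ_n C(σ,n)(y − 1)^n = ψ(σ)` ("`(1 + (y−1))^σ = y^σ`").
At `σ = m ∈ ℕ` this is the finite binomial theorem (`Ring.choose_natCast`); both sides are continuous
in `σ` (`PadicInt.continuous_choose`, uniform bound `‖C(σ,n)(y−1)^n‖ ≤ ‖y−1‖^n`); `ℕ` is dense in
`ℤ_p`. [cite: Washington1997, §5.1] -/
theorem R1.binomialUnit_hasValueAt {y : ℂ_[p]} (hy : ‖y - 1‖ < 1)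
    (ψ : Multiplicative ℤ_[p] →* ℂ_[p]ˣ) (hψc : Continuous ψ)
    (hψ1 : ((ψ (Multiplicative.ofAdd 1) : ℂ_[p]ˣ) : ℂ_[p]) = y) (σ : ℤ_[p]) :
    IntSeries.HasValueAt ((binomialSeries ℤ_[p] σ).map (R1.toCpInt p)) (y - 1)
      ((ψ (Multiplicative.ofAdd σ) : ℂ_[p]ˣ) : ℂ_[p]) := by
  -- the terms, as functions of `σ`
  set F : ℤ_[p] → ℕ → ℂ_[p] := fun τ n =>
    algebraMap ℚ_[p] ℂ_[p] ((Ring.choose τ n : ℤ_[p]) : ℚ_[p]) * (y - 1) ^ n with hF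
  have hterm : ∀ τ n, ((coeff n ((binomialSeries ℤ_[p] τ).map (R1.toCpInt p)) : 𝓞_ℂ_[p]) : ℂ_[p]) *
      (y - 1) ^ n = F τ n := fun τ n => by rw [hF, R1.coeff_binomialUnit]
  -- casts of binomial coefficients at natural arguments
  have hchoose : ∀ m n : ℕ, ((Ring.choose (m : ℤ_[p]) n : ℤ_[p]) : ℚ_[p]) = (Nat.choose m n : ℚ_[p]) := by
    intro m n
    rw [Ring.choose_natCast]
    push_cast
    rfl
  -- uniform bound and continuity of each term
  have hbound : ∀ (n : ℕ) (τ : ℤ_[p]), ‖F τ n‖ ≤ ‖y - 1‖ ^ n := fun n τ => by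
    rw [hF, norm_mul, norm_pow]
    exact mul_le_of_le_one_left (pow_nonneg (norm_nonneg _) _) (R1.norm_algebraMap_padicInt_le_one _)
  have hcont : ∀ n, Continuous fun τ => F τ n := fun n => by
    simp only [hF]
    refine Continuous.mul ?_ continuous_const
    exact (continuous_algebraMap ℚ_[p] ℂ_[p]).comp
      (continuous_subtype_val.comp (PadicInt.continuous_choose n))
  have hsum : Summable fun n : ℕ => ‖y - 1‖ ^ n := summable_geometric_of_lt_one (norm_nonneg _) hy
  -- the sum `τ ↦ Σ' F τ n` is continuous in `τ`
  have hSc : Continuous fun τ => ∑' n, F τ n := continuous_tsum hcont hsum hbound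
  have hFs : ∀ τ, Summable (F τ) := fun τ => Summable.of_norm_bounded hsum (fun n => hbound n τ)
  -- the right-hand side is continuous in `τ`
  set G : ℤ_[p] → ℂ_[p] := fun τ => ((ψ (Multiplicative.ofAdd τ) : ℂ_[p]ˣ) : ℂ_[p]) with hG
  have hGc : Continuous G :=
    Units.continuous_val.comp (hψc.comp continuous_ofAdd)
  -- agreement on `ℕ`: the finite binomial theorem
  have hnat : ∀ m : ℕ, ∑' n, F (m : ℤ_[p]) n = G (m : ℤ_[p]) := by
    intro m
    have hFm : ∀ n, F (m : ℤ_[p]) n = (Nat.choose m n : ℂ_[p]) * (y - 1) ^ n := fun n => by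
      simp only [hF, hchoose, map_natCast]
    have hfin : ∀ n ∉ range (m + 1), F (m : ℤ_[p]) n = 0 := by
      intro n hn
      rw [hFm, Nat.choose_eq_zero_of_lt (by simpa using hn), Nat.cast_zero, zero_mul]
    rw [tsum_eq_sum hfin]
    have hG' : G (m : ℤ_[p]) = y ^ m := by
      simp only [hG]
      rw [show Multiplicative.ofAdd ((m : ℕ) : ℤ_[p]) = (Multiplicative.ofAdd (1 : ℤ_[p])) ^ m by
        rw [← ofAdd_nsmul, nsmul_eq_mul, mul_one], map_pow, Units.val_pow_eq_pow_val, hψ1]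
    rw [hG', show y = (y - 1) + 1 by ring, add_pow]
    simp only [one_pow, mul_one]
    refine sum_congr rfl fun n _ => ?_
    rw [hFm, mul_comm]
  -- density of `ℕ` in `ℤ_p`
  have hall : ∀ τ : ℤ_[p], ∑' n, F τ n = G τ := by
    intro τ
    have hclosed : IsClosed {τ : ℤ_[p] | ∑' n, F τ n = G τ} := isClosed_eq hSc hGc
    have hdense : Dense (Set.range (Nat.cast : ℕ → ℤ_[p])) := PadicInt.denseRange_natCast
    have hsub : Set.range (Nat.cast : ℕ → ℤ_[p]) ⊆ {τ : ℤ_[p] | ∑' n, F τ n = G τ} := by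
      rintro _ ⟨m, rfl⟩; exact hnat m
    have := hclosed.closure_subset_iff.mpr hsub
    rw [hdense.closure_eq] at this
    exact this (Set.mem_univ τ)
  -- conclude
  have hgoal : HasSum (F σ) (G σ) := by rw [← hall σ]; exact (hFs σ).hasSum
  unfold IntSeries.HasValueAt
  simp_rw [hterm]
  exact hgoal

end Summit.BirchSwinnertonDyer.Rank1Residual.X11b

end
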